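import Summits.AtomisticToContinuum.Crystallization.Theorems.ChartedZeroExcessLayeredLatticeLiouvilleYHA

/-!
# Charted zero-excess layered-lattice Liouville — YH «MildEnclosure + SlavingSplit» — part 2 of 2 (sequel of `…ChartedZeroExcessLayeredLatticeLiouvilleYHA`)

Split for the 400-line cap by the landing lane (hand-2 g32); the module docstring of part 1 (`…ChartedZeroExcessLayeredLatticeLiouvilleYHA`) describes the whole node.  Same namespace; all FQNs unchanged.
0 sorry; standard axioms.
-/

noncomputable section
open scoped BigOperators Classical
open MeasureTheory Set Metric Filter Topology
open Summit.AtomisticToContinuum.Crystallization.Theorems.ChartedPlanarOrderRigidityDoor (E3 eStar atomsIn IsEStarGSC siteEnergy VisibleGap PertRegime)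
open Summit.AtomisticToContinuum.Crystallization.Theorems.ChartedPlanarOrderDensityDichotomy (μS IsSep nK nK_nonneg)
open Summit.AtomisticToContinuum.Crystallization.Theorems.ChartedPlanarOrderCleanScaleP (IsCleanP IsDoorSetP)
open Summit.AtomisticToContinuum.Crystallization.Theorems.ChartedPlanarOrderMesoCut (LayeredHom EnvClose)
open Summit.AtomisticToContinuum.Crystallization.Theorems.ChartedPlanarOrderDoorLayered (atomsIn_subset sq_le_finsum_mem PeriodicBulkGapDoor)
open Summit.AtomisticToContinuum.Crystallization.Theorems.ChartedPlanarOrderDoorLayeredOsc (IsTwoShellAffineGood)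
open Literature.MathematicalPhysics.StatisticalMechanics (card_le_of_separated_of_dist_le lennardJones)

namespace Summit.AtomisticToContinuum.Crystallization.Theorems.ChartedZeroExcessLayeredLatticeLiouville

/-! ### YH-3  Column `_16XH26B`: the column of record with its door made MILD and the wild leaf added — every binder implied by `_16XH24B` -/

/-- ★★★ **COLUMN `_16XH26B`** — `_16XH24B` (part YF, column of record by CRITIC-LEDGER row 1187 (a)) with its door [CMC] replaced by the MILD door [MCMC]
`MildCoolMoatCorePG (1/100) tameRadius (1/10) 8 4 12 16 1 2 (1/16) (1/50)`, its residuals [SSHSᵇ], [BSHSᵇ] replaced by their MILD sub-counts [MSSHSᵇ](…, 1/10, 24),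
[MBSHSᵇ](…, 1/10, 24), and ONE added binder [WHSᵇ](1/10) `HotSparseBPG (1/10) 1 2 (1/16) (1/50)`; [I_D], [TBISᵇ(8)], the 20 generic leaves and `PeriodicBulkGapDoor 2`
unchanged ⇒ `VisibleGap (1/50) ∧ PertRegime (1/50)`.  EVERY binder is implied by those of `_16XH24B` (`mild_docket_of_record_16XH24B`, PROVED). [this file, g64] -/
theorem gap_and_pert_1_50_of_certs_16XH26B (hL : LatticeLiouvilleCert) (hL' : LayeredLiouvilleCert)
    (hR : OscRigidityL2BDPG 1 2 (1 / 16) (1 / 16)) (hX : ExcessFlatnessControlP 1 2 (1 / 16) (1 / 16))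
    (hE : ExcessChartLocalisationP 1 2 (1 / 16) (1 / 100)) (hP : RegistrationP 1 2 (1 / 16) (1 / 100))
    (hT : TailDominationCert) (hU : UniformTameStabilityE (1 / 50) 2 (1 / 2000))
    (h1 : WordTransplantP 1 2 (1 / 16) (1 / 100)) (hGT : GradReframingThickP 1 2 (1 / 16) (1 / 100) (1 / 50))
    (hΛ0 : LaunderingAprioriPX 1 2 (1 / 16) (1 / 100) (1 / 50)) (hΛs : LaunderingStepPX 1 2 (1 / 16) (1 / 100) (1 / 50))
    (hUc : UntwistCollarP 1 2 (1 / 16) (1 / 50))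
    (hl : BondIsoLevelsP 1 2 (1 / 16) (1 / 50)) (hN : EnergyNearChartPX 1 2 (1 / 16) (1 / 50) (1 / 2000))
    (hF : TailForceSlavingP 1 2 (1 / 16) (1 / 50))
    (hE' : LipDualLinearisationP 1 2 (1 / 16) (1 / 50)) (hA : L2HarmonicApproxPE 1 2 (1 / 16) (1 / 50) (1 / 2000))
    (hD : PositionDecayPLE 1 2 (1 / 16) (1 / 50) (1 / 2000)) (hC : PositionCaccioppoliPGE 1 2 (1 / 16) (1 / 50) (1 / 2000))
    (hI : DressedCorePG tameRadius dressLevel dressLevel dressExponent 8 collarRadius clusterSize 1 2 (1 / 16) (1 / 50))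
    (hMCMC : MildCoolMoatCorePG (1 / 100) tameRadius (1 / 10) 8 4 12 16 1 2 (1 / 16) (1 / 50))
    (hMSSH : MildSlenderSereneHotSparseBPG (1 / 100) tameRadius 8 24 dressLevel dressLevel dressExponent 8 collarRadius clusterSize 4 32 8 (1 / 10) 24
      1 2 (1 / 16) (1 / 50))
    (hMBSH : MildBuriedSereneHotSparseBPG (1 / 100) tameRadius 8 24 dressLevel dressLevel dressExponent 8 collarRadius clusterSize 8 (1 / 10) 24
      1 2 (1 / 16) (1 / 50))
    (hWHS : HotSparseBPG (1 / 10) 1 2 (1 / 16) (1 / 50))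
    (hTBIS : TameBallIncoherenceSparseBPG (1 / 100) (1 / 200) tameRadius 8 1 2 (1 / 16) (1 / 50))
    (hG : PeriodicBulkGapDoor 2) : VisibleGap (1 / 50) ∧ PertRegime (1 / 50) :=
  gap_and_pert_1_50_of_certs_16XH18B_tol hL hL' hR hX hE hP hT hU h1 hGT hΛ0 hΛs hUc (untwistBookkeepingP_one 2 (1 / 50)) hl hN hF hE' hA hD hC
    (wildFractionBPG_of_dressedCore_serene_tameBallIncoherent (by norm_num [tameRadius]) (by norm_num) (by norm_num) (by norm_num) le_rfl hI
      (sereneBareHotSparseBPG_of_mild_hot (by norm_num) (by norm_num)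
        (mildSereneBareHotSparseBPG_of_mildCoolMoat_slender_buried (by norm_num) (by norm_num) (by norm_num) (by norm_num) (by norm_num) hMCMC hMSSH hMBSH)
        hWHS) hTBIS) hG

/-- ★★ **THE COLUMN OF RECORD ⇒ THE MILD DOCKET (PROVED)**: the five B-body binders [I_D], [CMC], [SSHSᵇ], [BSHSᵇ], [TBISᵇ(8)] of `_16XH24B` give the four new
ones of `_16XH26B` — [MCMC] (hypothesis added), [MSSHSᵇ], [MBSHSᵇ] (sub-counts) and [WHSᵇ](1/10) (part YF's glue gives [SBHSᵇ](24), part YE/YD's chain gives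
[HSᵇ](1/20), part YG's dial gives [HSᵇ](1/10)). [this file, g64] -/
theorem mild_docket_of_record_16XH24B
    (hI : DressedCorePG tameRadius dressLevel dressLevel dressExponent 8 collarRadius clusterSize 1 2 (1 / 16) (1 / 50))
    (hCMC : CoolMoatCorePG (1 / 100) tameRadius 8 4 12 1 2 (1 / 16) (1 / 50))
    (hSSH : SlenderSereneHotSparseBPG (1 / 100) tameRadius 8 24 dressLevel dressLevel dressExponent 8 collarRadius clusterSize 4 32 8 1 2 (1 / 16) (1 / 50))
    (hBSH : BuriedSereneHotSparseBPG (1 / 100) tameRadius 8 24 dressLevel dressLevel dressExponent 8 collarRadius clusterSize 8 1 2 (1 / 16) (1 / 50))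
    (hTBIS : TameBallIncoherenceSparseBPG (1 / 100) (1 / 200) tameRadius 8 1 2 (1 / 16) (1 / 50)) :
    MildCoolMoatCorePG (1 / 100) tameRadius (1 / 10) 8 4 12 16 1 2 (1 / 16) (1 / 50) ∧
      MildSlenderSereneHotSparseBPG (1 / 100) tameRadius 8 24 dressLevel dressLevel dressExponent 8 collarRadius clusterSize 4 32 8 (1 / 10) 24
        1 2 (1 / 16) (1 / 50) ∧
      MildBuriedSereneHotSparseBPG (1 / 100) tameRadius 8 24 dressLevel dressLevel dressExponent 8 collarRadius clusterSize 8 (1 / 10) 24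
        1 2 (1 / 16) (1 / 50) ∧
      HotSparseBPG (1 / 10) 1 2 (1 / 16) (1 / 50) :=
  ⟨mildCoolMoatCorePG_of_coolMoatCore hCMC, mildSlenderSereneHotSparseBPG_of_slender hSSH, mildBuriedSereneHotSparseBPG_of_buried hBSH,
    hotSparseBPG_of_serene_record (by norm_num) (by norm_num) le_rfl (by norm_num [tameRadius]) hI
      (sereneBareHotSparseBPG_of_coolMoat_slender_buried (by norm_num) (by norm_num) (by norm_num) (by norm_num) hCMC hSSH hBSH) hTBIS⟩

/-! ### YH-4  (K3′) SLAVING and (K01) MATCHING typed (row 1187 (c)(i)); `[CMCᶜ] ⟸ (K3′) ∧ (K01)` PROVED; column `_16XH24BS` -/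

/-- ★★ **(K3′) «CoolMoatSlavingP ϑc ϑ' r q rsh ρ ρ' aHi Λ θ s» — SLAVING / INTERIOR REGULARITY UP TO THE CHART.**  Under the binders of part YF's [CMCᶜ] (door
`IsDoorSetP`, summable pair sums, θ-good, equilibrium `s`-chart `(L, w)` about scale `a`, container `K ⊆ S ∩ B̄(x₀, q)` with `ϑc`-tame moat `moatIn S K r (r + rsh)`
for `LayeredHom L w`, grand clamped minimality of the `ρ`-core): the `ρ'`-core `coreOf S K ρ'` is `ϑ'`-TAME for SOME equilibrium `s`-chart `(L′, w′)` about the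
same scale — «a clamped clean minimiser with cool thick-shell data is UNIFORMLY close to SOME homogeneous equilibrium state on the whole core» (E–Ming 2007 /
Ortner–Theil 2013: the solution lies within `C·(data)` of a Cauchy–Born state in `W^{1,∞}`; the chart may differ from `(L, w)` because the data are tilt-blind
and word-blind).  Record `(ϑc, ϑ', r, q, rsh, ρ, ρ') = (1/100, 1/60, 8, 4, 12, 16, 20)` (`ρ' = r + rsh`: the tame core COVERS the moat, the overlap (K01) needs).
SIDEWAYS w.r.t. [CMCᶜ] (honest: conclusion at the lower level `ϑ' < ϑ` on the larger region `coreOf S K ρ' ⊇ K`, for an unnamed chart) · ENERGY · LOCAL · FINITE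
· UNDECIDED · ATTACKABLE·L · INSTRUMENTABLE («CoolMoatGap» reporting the best-fitting chart of the relaxed core).  In the MILD class (`coreOf S K rm` `ϑp`-tame
for `(L, w)`) the statement with `L′ := L`, `w′ := w` is part YH's [MCMCᶜ] up to the trivial same-chart matching.
Why it might fail: a clamped minimiser that is clean and Nash but GRADED (strain drifting by more than `ϑ'` across the `20`-core, e.g. a bent lamella) is
`ϑ'`-tame for NO single homogeneous chart although tame for a slowly varying family — `ϑ' = 1/60` over diameter `≈ 48` tolerates strain gradients `≲ 3·10⁻⁴`
per unit length only; the cool moat (`1 %` flat data on thickness `12`) should pin the gradient at `≲ 10⁻³/12`, marginal.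
Sources: part YF ([CMCᶜ], HONEST PLACEMENT (1)); E–Ming, Arch. Ration. Mech. Anal. 183 (2007) 241; Ortner–Theil, Arch. Ration. Mech. Anal. 207 (2013) 1025;
Braun–Schmidt, arXiv 1604.00197; CRITIC-LEDGER rows 1181 (c2), 1187 (c)(i). [this file, g64] -/
def CoolMoatSlavingP (ϑc ϑ' r q rsh ρ ρ' aHi Λ θ s : ℝ) : Prop :=
  ∀ δ : ℝ, 0 < δ → ∀ a : ℝ, 0 < a →
    ∀ S : Set E3, IsDoorSetP aHi δ S → (∀ z : E3, Summable fun y : S => lennardJones (dist z (y : E3))) →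
      (∀ p ∈ S, IsTwoShellAffineGood θ S p) →
        ∀ (L : E3 ≃L[ℝ] E3) (w : ℤ → E3), IsEquilChart a s Λ L w →
          ∀ (x₀ : E3) (K : Set E3), K ⊆ S → (∀ k ∈ K, dist k x₀ ≤ q) →
            IsTameOn ϑc S (LayeredHom (L : E3 →L[ℝ] E3) w) (moatIn S K r (r + rsh)) →
              IsGrandClampedMin S (coreOf S K ρ) →
                ∃ (L' : E3 ≃L[ℝ] E3) (w' : ℤ → E3), IsEquilChart a s Λ L' w' ∧ IsTameOn ϑ' S (LayeredHom (L' : E3 →L[ℝ] E3) w') (coreOf S K ρ')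

/-- ★★ **(K01) «ChartMatchingP ϑc ϑ' ϑ r q rsh ρ' aHi Λ θ s» — CHART MATCHING (KINEMATIC).**  For every θ-good `aHi`-door set `S` (`IsDoorSetP`; NO energy
hypothesis), every two equilibrium `s`-charts `(L, w)`, `(L′, w′)` about the same scale, every container `K ⊆ S ∩ B̄(x₀, q)`: IF the moat `moatIn S K r (r + rsh)`
is `ϑc`-tame for `LayeredHom L w` AND the `ρ'`-core `coreOf S K ρ'` is `ϑ'`-tame for `LayeredHom L′ w′`, THEN `K` is `ϑ`-tame for `LayeredHom L w`.  The
same-chart instance is trivial (`isTameOn_of_isTameOn_coreOf`); the content is `L′ ≠ L` (another strain / tilt) and `w′ ≠ w` (another word / registry).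
Record `(ϑc, ϑ', ϑ, r, q, rsh, ρ') = (1/100, 1/60, 1/20, 8, 4, 12, 20)`.  MECHANISM («layer mates»): a door set is CLEAN everywhere, hence GLOBALLY LAYERED
(`IsCharted`: no partial dislocation is two-shell good), so every `K`-star has a layer-mate star IN THE MOAT with the SAME local stacking word; both are
`ϑ'`-close to `L′`-patterns with equal word windows, which are CONGRUENT up to `ε_w` (equilibrium charts are homogeneous; inner displacements are
word-determined, part TH (B1) mechanism, `ε_w ≈ 10⁻³`); the mate is `ϑc`-close to an `L`-pattern; so the `K`-star is `(2ϑ' + ϑc + ε_w)`-close to an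
`L`-pattern — LEVEL BUDGET `2ϑ' + ϑc + ε_w ≤ ϑ`, met at the record (`1/30 + 1/100 + 10⁻³ < 1/20`) and NOT met at `ϑ' = ϑ/2`.  KINEMATIC · SIDEWAYS (not implied
by [CMCᶜ]) · TRUE-type at the record levels · ATTACKABLE·M–L (remaining formal work: STAR-BOUNDARY COHERENCE — patching the mate's `g`-map to the `K`-star's
support across the `4`-sphere, an `UntwistCollarP`-type step — and the chart word-rigidity `ε_w`).
Why it might fail: star-boundary bookkeeping — a site at distance `4 ± 0` from the `K`-star centre whose mate image falls outside the mate's `4`-star has no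
certified position (needs the pattern EXTENSION property of homogeneous charts, true but to be proved), and `ε_w` must be certified uniformly over words.
Sources: part TH ((B1) `WordTransplantP` mechanism, `isCharted_of_isEquilChart`); part TM (`UntwistCollarP`); part YF (foreseen split (K3′)/(K01));
Conway–Sloane, Sphere Packings Ch. 1 §1.3 (Barlow words); CRITIC-LEDGER row 1187 (c)(i). [this file, g64] -/
def ChartMatchingP (ϑc ϑ' ϑ r q rsh ρ' aHi Λ θ s : ℝ) : Prop :=
  ∀ δ : ℝ, 0 < δ → ∀ a : ℝ, 0 < a →
    ∀ S : Set E3, IsDoorSetP aHi δ S → (∀ p ∈ S, IsTwoShellAffineGood θ S p) →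
      ∀ (L : E3 ≃L[ℝ] E3) (w : ℤ → E3), IsEquilChart a s Λ L w → ∀ (L' : E3 ≃L[ℝ] E3) (w' : ℤ → E3), IsEquilChart a s Λ L' w' →
        ∀ (x₀ : E3) (K : Set E3), K ⊆ S → (∀ k ∈ K, dist k x₀ ≤ q) →
          IsTameOn ϑc S (LayeredHom (L : E3 →L[ℝ] E3) w) (moatIn S K r (r + rsh)) →
            IsTameOn ϑ' S (LayeredHom (L' : E3 →L[ℝ] E3) w') (coreOf S K ρ') →
              IsTameOn ϑ S (LayeredHom (L : E3 →L[ℝ] E3) w) K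

/-- the SAME-CHART instance of matching is trivial (PROVED): a `ϑ'`-tame `ρ'`-core (`0 ≤ ρ'`, `ϑ' ≤ ϑ`) contains its container, which is then `ϑ`-tame —
so (K01)'s content is entirely in the change of chart. [this file, g64] -/
theorem isTameOn_of_isTameOn_coreOf {ϑ' ϑ ρ' : ℝ} (hle : ϑ' ≤ ϑ) (hρ : 0 ≤ ρ') {S H K : Set E3} (hKS : K ⊆ S) (h : IsTameOn ϑ' S H (coreOf S K ρ')) :
    IsTameOn ϑ S H K :=
  IsTameOn.mono hle (fun k hk => show k ∈ S ∧ ∃ k' ∈ K, dist k k' ≤ ρ' from ⟨hKS hk, k, hk, by rw [dist_self]; exact hρ⟩) h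

/-- ★★★ **[CMCᶜ] ⟸ (K3′) ∧ (K01) (PROVED)** — slaving produces the chart, matching transports tameness back to the column's chart. [this file, g64] -/
theorem coolMoatClampedCoreP_of_slaving_matching {ϑc ϑ' ϑ r q rsh ρ ρ' aHi Λ θ s : ℝ} (hS3 : CoolMoatSlavingP ϑc ϑ' r q rsh ρ ρ' aHi Λ θ s)
    (hM : ChartMatchingP ϑc ϑ' ϑ r q rsh ρ' aHi Λ θ s) : CoolMoatClampedCoreP ϑc ϑ r q rsh ρ aHi Λ θ s := by
  intro δ hδ a ha S hS hsum hgood L w hLw x₀ K hKS hKq hcool hmin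
  obtain ⟨L', w', hLw', htame⟩ := hS3 δ hδ a ha S hS hsum hgood L w hLw x₀ K hKS hKq hcool hmin
  exact hM δ hδ a ha S hS hgood L w hLw L' w' hLw' x₀ K hKS hKq hcool htame

/-- **[CMC] ⟸ (K3′) ∧ (K01) (PROVED)** — through part YF's `coolMoatCorePG_of_clamped`. [this file, g64] -/
theorem coolMoatCorePG_of_slaving_matching {ϑc ϑ' ϑ r q rsh ρ ρ' aHi Λ θ s : ℝ} (hS3 : CoolMoatSlavingP ϑc ϑ' r q rsh ρ ρ' aHi Λ θ s)
    (hM : ChartMatchingP ϑc ϑ' ϑ r q rsh ρ' aHi Λ θ s) : CoolMoatCorePG ϑc ϑ r q rsh aHi Λ θ s :=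
  coolMoatCorePG_of_clamped (coolMoatClampedCoreP_of_slaving_matching hS3 hM)

/-- **[MCMCᶜ] ⟸ (K3′) ∧ (K01) (PROVED)** — a fortiori. [this file, g64] -/
theorem mildCoolMoatClampedCoreP_of_slaving_matching {ϑc ϑ' ϑ ϑp r q rsh ρ ρ' rm aHi Λ θ s : ℝ} (hS3 : CoolMoatSlavingP ϑc ϑ' r q rsh ρ ρ' aHi Λ θ s)
    (hM : ChartMatchingP ϑc ϑ' ϑ r q rsh ρ' aHi Λ θ s) : MildCoolMoatClampedCoreP ϑc ϑ ϑp r q rsh ρ rm aHi Λ θ s :=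
  mildCoolMoatClampedCoreP_of_clamped (coolMoatClampedCoreP_of_slaving_matching hS3 hM)

/-- ★★ **COLUMN `_16XH24BS`** — `_16XH24B` with its door [CMC] replaced by the SPLIT (K3′) `CoolMoatSlavingP (1/100) (1/60) 8 4 12 16 20 1 2 (1/16) (1/50)` ∧ (K01)
`ChartMatchingP (1/100) (1/60) tameRadius 8 4 12 20 1 2 (1/16) (1/50)` (row 1187 (c)(i)); all other binders identical. [this file, g64] -/
theorem gap_and_pert_1_50_of_certs_16XH24BS (hL : LatticeLiouvilleCert) (hL' : LayeredLiouvilleCert)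
    (hR : OscRigidityL2BDPG 1 2 (1 / 16) (1 / 16)) (hX : ExcessFlatnessControlP 1 2 (1 / 16) (1 / 16))
    (hE : ExcessChartLocalisationP 1 2 (1 / 16) (1 / 100)) (hP : RegistrationP 1 2 (1 / 16) (1 / 100))
    (hT : TailDominationCert) (hU : UniformTameStabilityE (1 / 50) 2 (1 / 2000))
    (h1 : WordTransplantP 1 2 (1 / 16) (1 / 100)) (hGT : GradReframingThickP 1 2 (1 / 16) (1 / 100) (1 / 50))
    (hΛ0 : LaunderingAprioriPX 1 2 (1 / 16) (1 / 100) (1 / 50)) (hΛs : LaunderingStepPX 1 2 (1 / 16) (1 / 100) (1 / 50))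
    (hUc : UntwistCollarP 1 2 (1 / 16) (1 / 50))
    (hl : BondIsoLevelsP 1 2 (1 / 16) (1 / 50)) (hN : EnergyNearChartPX 1 2 (1 / 16) (1 / 50) (1 / 2000))
    (hF : TailForceSlavingP 1 2 (1 / 16) (1 / 50))
    (hE' : LipDualLinearisationP 1 2 (1 / 16) (1 / 50)) (hA : L2HarmonicApproxPE 1 2 (1 / 16) (1 / 50) (1 / 2000))
    (hD : PositionDecayPLE 1 2 (1 / 16) (1 / 50) (1 / 2000)) (hC : PositionCaccioppoliPGE 1 2 (1 / 16) (1 / 50) (1 / 2000))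
    (hI : DressedCorePG tameRadius dressLevel dressLevel dressExponent 8 collarRadius clusterSize 1 2 (1 / 16) (1 / 50))
    (hSlav : CoolMoatSlavingP (1 / 100) (1 / 60) 8 4 12 16 20 1 2 (1 / 16) (1 / 50))
    (hMatch : ChartMatchingP (1 / 100) (1 / 60) tameRadius 8 4 12 20 1 2 (1 / 16) (1 / 50))
    (hSSH : SlenderSereneHotSparseBPG (1 / 100) tameRadius 8 24 dressLevel dressLevel dressExponent 8 collarRadius clusterSize 4 32 8 1 2 (1 / 16) (1 / 50))
    (hBSH : BuriedSereneHotSparseBPG (1 / 100) tameRadius 8 24 dressLevel dressLevel dressExponent 8 collarRadius clusterSize 8 1 2 (1 / 16) (1 / 50))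
    (hTBIS : TameBallIncoherenceSparseBPG (1 / 100) (1 / 200) tameRadius 8 1 2 (1 / 16) (1 / 50))
    (hG : PeriodicBulkGapDoor 2) : VisibleGap (1 / 50) ∧ PertRegime (1 / 50) :=
  gap_and_pert_1_50_of_certs_16XH24B hL hL' hR hX hE hP hT hU h1 hGT hΛ0 hΛs hUc hl hN hF hE' hA hD hC hI
    (coolMoatCorePG_of_slaving_matching hSlav hMatch) hSSH hBSH hTBIS hG

end Summit.AtomisticToContinuum.Crystallization.Theorems.ChartedZeroExcessLayeredLatticeLiouville
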